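import Summits.QuantumFields.BalabanUV.T4Continuum.Support.OutputRateGaussianParamBi
import Summits.QuantumFields.BalabanUV.T4Continuum.Support.OutputRateOpGaussianParamMargin
import Summits.QuantumFields.BalabanUV.T4Continuum.Support.B13HistReadout

/-!
# B13TermParamGaussianBi — row O1-d2-ii «act instance» of the NE5 crux O1, part 2: THE DICTIONARY INSTANCE of the owner's ONE
# (2.14)-shape `OutputRateGaussianParamBi.TermGaussianParamBi` (ruling R18, design v0.5 §8) — a (2.14)-core in the bi-species
# Gaussian-parametrised format, its term `termBi`, and the shape PROVED from the core with the STRUCTURAL letters `F = 1` (characteristic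
# functions) and `N₁ = Σ_Y rad(Y)·level136` (history read-out through leaf-06's table) discharged; the operator letters displayed
# (cell `pub-balaban`, T⁴ fan-out, `HOME/t4/b2b-balaban-t4-ne5-p1/O1-CLAIM-TABLE-NE5-P1.md` row O1-d2-ii; design v0.5 R18)

Unit `b2b-balaban-t4-ne5-formalise-leaf-08` (NE5 formalisation swarm, leaf prover 08, gen 2).  Summits-side NEW WORK under the LEAN
PLACEMENT RULE (cell modelling + bookkeeping; nothing of the manuscripts under audit is asserted; 0 cite tags).  HONEST FRAMING: rung
(B)+1 of the FINITE-VOLUME T⁴ continuum programme — NOT infinite volume, NOT a mass gap, NOT the Clay problem, NOT a proof of NE5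
(`T4OutputRate.NE5` is NOT PRINTED and NOT PROVED; spine 0/9, unchanged).  HONEST DEPENDENCY (cell line, verbatim): continuum YM on T⁴ ⇐
BetaPertH ∧ nine spine estimates (0/9 proved); BetaPertH ⇐ (D1) ∧ (D4) ∧ CAP+tail; G-an2-4 gates asym, D1 and NE2/3/4.

WHAT THIS MODULE IS.  Part 1 (`B13TermParam`, p214580) located that ONE resummed term of [Balaban1988RG2Cluster] (2.14) p. 15 is a
CONTOUR INTEGRAL over `p = (s, σ, t, τ)` of term data.  The row owner's ruling R18 names the TARGET SHAPE OF RECORD for such cores: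
`TermGaussianParamBi T W ctr RHist R′ lam w N F₀ Λ q m b w₀ N₀ F N₁` (p214940) — finite parameter measure outside, bounded holomorphic
normalisation `N(o, p)`, potential-free factor `F₀`, EXP-LINEAR history insertion `exp(Λ(p, v)·h)`, exponent `q(o, p, v)` with an affine
margin, ITERATED representation — from which BOTH W2 species and the END follow BY NAME.  This file supplies the holder's side (R18 (a) and
the structural half of (b)):
* §1 `BiCore P dom Op PΛ V` — ONE core: the contour-parameter measure `lam` (finite) and measurable Cauchy weight `w` (`‖w‖ ≤ wB`); the
  operator LETTERS `N : Op → PΛ → ℂ`, `q : Op → PΛ → V → ℂ` (Gaussian volumes and the quadratic form of `C^{(k)}(Z₀, σ)`, `Γ_k` — rows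
  NE2∕NE3's objects, named parameters here); the (2.3) p. 12 characteristic-function data (a LIST of constraints — continuous linear bond
  read-out, threshold, small∕large flag — so that products of cores are cores); the history read-out data (polymer family `D`,
  measurable contour weights `τ : PΛ → 𝒴 → ℂ` on circles of radii `rad`, measurable field maps `B Y : V → P.Arg (dom Y)`).  The
  fluctuation-field space `V` is a finite-dimensional real inner-product space; its `volume` is `measureSpaceOfInnerProductSpace` (R18 (a)).
* §2 `chi` — the potential-free factor `(−1)^{nsign}·𝟙[every constraint holds]`: `measurable_chi`, `norm_chi_le_one` (LETTER `F = 1`).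
* §3 `readOut p v := Σ_{Y∈D} τ p Y • VppCLMM P (dom Y) (B Y v) : B13HistM P →L[ℂ] ℂ` — the history read-out through leaf-06's table:
  `readOut_apply`, `norm_readOut_le` (LETTER `N₁ := Σ_{Y∈D} rad Y·level136 (d (dom Y))`, R18's «Σ|τ(Y)|× the (1.36)-budget letter»),
  `N₁_nonneg`, `measurable_readOut_apply` (joint measurability in `(p, v)` for every table).
* §4 `termBi 𝔊 k i o h X` — the term of a family `𝔊 k i X : BiCore …` as the ITERATED integral of the shape, and the headline
  **`termGaussianParamBi_termBi`**: `TermGaussianParamBi (termBi 𝔊) W ctr RHist R′ lam w N chi readOut q m b wB N₀ 1 N₁` with the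
  clauses on `lam`, `w`, `F₀`, `Λ` and the representation PROVED from the core, and the operator letters (`0 < m`; `N` measurable ∕
  holomorphic ∕ `≤ N₀` on the operator ball; `q` measurable ∕ holomorphic ∕ affine margin `m‖v‖² − b ≤ Re q`) DISPLAYED as ∀-binders.
* §5 `margin_of_base` — the affine-margin binder of §4 from the DECOUPLED base exponent `q₀` (margin `m₀`, [II] (2.15) KIND), the
  σ-coupling displacement `m₂` and the operator reach `m₁R′` (the owner's `re_ge_shift_of_baseMargin_param_lipschitz`): margin
  `m₀ − m₂ − m₁R′`, alive iff `m₂ + m₁R′ < m₀` — ARITHMETIC.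
* §6 `termGaussianParamBi_termBi_toy` — NON-VACUITY of §4's displayed binders: with the decoupled toy letters `N := 1`, `q := ‖v‖²`
  they hold (`m = 1`, `b = 0`, `N₀ = 1`), so the shape is inhabited by `termBi` (a test, not a model of [II]).

STATUS (census, Edison rule).  Dictionary∕bookkeeping.  Of R18 (b)'s letters, `F = 1` and `N₁` are now THEOREMS of the core; `w₀ = wB`,
`N₀`, the margin letters and the mass budget `paramMass ≤ a·e^{−κd(X)}` remain DISPLAYED (the concrete contour products — part 3 — and the
Gaussian data of `C^{(k)}(Z₀, σ)` — rows NE2∕NE3 — are not typed here).  No estimate of [II] is proved or asserted; NE5 NOT PROVED; 0/12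
leaves on Bałaban's concrete objects; spine 0/9; rung (B)+1 finite T⁴; NOT infinite volume ∕ mass gap ∕ Clay.  0 sorry; axioms ⊆
{propext, Classical.choice, Quot.sound}.
-/

noncomputable section

open scoped BigOperators
open Set Metric MeasureTheory Finset

namespace Summit.QuantumFields.BalabanUV.T4Continuum.B13TermParamGaussianBi

open Literature.MathematicalPhysics.QuantumFieldTheory.Balaban1983to89
open Literature.MathematicalPhysics.QuantumFieldTheory.Balaban1983to89.T4OutputRate (Carriers)
open Summit.QuantumFields.BalabanUV.T4Continuum.B13HistDatum (level136 level136_pos)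
open Summit.QuantumFields.BalabanUV.T4Continuum.B13HistMeasurable (MeasPotFrame B13HistM)
open Summit.QuantumFields.BalabanUV.T4Continuum.B13HistReadout (VppCLMM VppCLMM_apply norm_VppCLMM_le readVpp readVpp_eq_clm
  measurable_readVpp)
open Summit.QuantumFields.BalabanUV.T4Continuum.OutputRateGaussianParamBi (TermGaussianParamBi)
open Summit.QuantumFields.BalabanUV.T4Continuum.OutputRateOpGaussianParamMargin (re_ge_shift_of_baseMargin_param_lipschitz)

variable {C : Carriers} (P : MeasPotFrame C) {𝒴 : Type*} (dom : 𝒴 → C.Dom)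

/-! ## §1 One (2.14)-core in the bi-species Gaussian-parametrised format -/

/-- ONE (2.14)-CORE IN THE FORMAT OF `TermGaussianParamBi` (modelling; nothing asserted).  `PΛ` = the contour∕interpolation parameters
`p = (s, σ, t, τ)` with their FINITE measure `lam` and measurable Cauchy weight `w` (`‖w p‖ ≤ wB`); `V` = the fluctuation fields
`v = (X, B)` of the step (finite-dimensional real inner-product space, flat `volume`); the operator LETTERS `N` (normalisation prefactor)
and `q` (exponent); the characteristic-function constraints of (2.3) (`cons`, `nsign`); the history read-out data (`D`, `τ`, `rad`, `B`) read through leaf-06's table space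
`B13HistM P` at the carrier domains `dom Y`. [folklore] -/
structure BiCore (Op PΛ V : Type*) [MeasurableSpace PΛ] [NormedAddCommGroup V] [NormedSpace ℝ V] [MeasurableSpace V] where
  /-- the contour-parameter measure (product of `ds`, `dσ∕2πi`-arc-length, `dt`, `dτ∕2πi`-arc-length in (2.14)) -/
  lam : Measure PΛ
  /-- it is finite -/
  finite : IsFiniteMeasure lam
  /-- the Cauchy weight `Π (σ(Δ) − s(Δ))⁻² Π (τ(Y) − t(Y))⁻²` (with its `(2πi)⁻¹`'s) -/
  w : PΛ → ℂ
  /-- measurable -/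
  measW : Measurable w
  /-- its uniform bound (the letter `w₀`) -/
  wB : ℝ
  /-- the bound -/
  norm_w_le : ∀ p, ‖w p‖ ≤ wB
  /-- LETTER: the normalisation prefactor (Gaussian volumes at `(Z₀, σ(p))`) -/
  N : Op → PΛ → ℂ
  /-- LETTER: the exponent (the quadratic form of the Gaussian data at `(Z₀, σ(p))` in the flat variables) -/
  q : Op → PΛ → V → ℂ
  /-- the characteristic-function CONSTRAINTS of (2.3): each one a continuous linear bond read-out of the fluctuation field, a threshold
  (`ε₁∕g_k` KIND) and a flag — `true`: the bond variable is constrained SMALL (`χ_{k,Y₀}`: `|b v| < thr`), `false`: constrained LARGE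
  (`χᶜ_{k,P}`: `thr ≤ |b v|`).  A LIST, so that PRODUCTS of cores (concatenation) are cores. -/
  cons : List ((V →L[ℝ] ℝ) × ℝ × Bool)
  /-- the sign exponent `|P|` of `(−1)^{|P|}` -/
  nsign : ℕ
  /-- the polymer family `𝐃` of the term -/
  D : Finset 𝒴
  /-- the contour weights `τ(Y)` as functions of the parameter -/
  τ : PΛ → 𝒴 → ℂ
  /-- measurable in the parameter -/
  measτ : ∀ Y, Measurable fun p => τ p Y
  /-- the radii of the `τ(Y)`-circles ((2.18) KIND) -/
  rad : 𝒴 → ℝ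
  /-- nonnegative -/
  rad_nonneg : ∀ Y, 0 ≤ rad Y
  /-- the weights live on (or inside) the circles -/
  norm_τ_le : ∀ p Y, ‖τ p Y‖ ≤ rad Y
  /-- the field maps `v ↦ B|_Y` into the frame's argument space at `dom Y` -/
  B : (Y : 𝒴) → V → P.Arg (dom Y)
  /-- measurable -/
  measB : ∀ Y, Measurable (B Y)

namespace BiCore

variable {P dom}
variable {Op PΛ V : Type*} [MeasurableSpace PΛ] [NormedAddCommGroup V] [InnerProductSpace ℝ V] [MeasurableSpace V]
  (𝔠 : BiCore P dom Op PΛ V)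

/-! ## §2 The potential-free factor: characteristic functions -/

/-- The set cut out by ONE characteristic-function constraint (`true`: small field, `false`: large field). [folklore] -/
def consSet (c : (V →L[ℝ] ℝ) × ℝ × Bool) : Set V := bif c.2.2 then {v | |c.1 v| < c.2.1} else {v | c.2.1 ≤ |c.1 v|}

/-- The constraint set of the characteristic functions: every constraint of the list holds. [folklore] -/
def chiSet : Set V := {v | ∀ c ∈ 𝔠.cons, v ∈ consSet c}

/-- THE POTENTIAL-FREE FACTOR `(−1)^{|P|}·χ_{k,Y₀}·χᶜ_{k,P}` of (2.14) ((2.3) p. 12 KIND): a sign times the indicator of `chiSet`. [folklore] -/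
def chi (v : V) : ℂ := 𝔠.chiSet.indicator (fun _ => (-1 : ℂ) ^ 𝔠.nsign) v

/-- [folklore] **LETTER `F = 1`**: `‖chi v‖ ≤ 1`. -/
theorem norm_chi_le_one (v : V) : ‖𝔠.chi v‖ ≤ 1 := by
  unfold chi
  by_cases hv : v ∈ 𝔠.chiSet
  · rw [Set.indicator_of_mem hv]; simp
  · rw [Set.indicator_of_notMem hv]; simp

variable [BorelSpace V]

/-- [folklore] One constraint cuts out a measurable set (a strict or a weak inequality on a continuous linear read-out). -/
theorem measurableSet_consSet (c : (V →L[ℝ] ℝ) × ℝ × Bool) : MeasurableSet (consSet c) := by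
  obtain ⟨b, thr, flag⟩ := c
  have hb : Measurable fun v : V => |b v| := (continuous_abs.comp b.continuous).measurable
  cases flag
  · exact measurableSet_le measurable_const hb
  · exact measurableSet_lt hb measurable_const

/-- [folklore] The constraint set is measurable (finitely many strict∕weak inequalities on continuous linear read-outs). -/
theorem measurableSet_chiSet : MeasurableSet 𝔠.chiSet := by
  have h : 𝔠.chiSet = ⋂ c ∈ {c | c ∈ 𝔠.cons}, consSet c := by
    ext v; simp only [chiSet, Set.mem_setOf_eq, Set.mem_iInter]
  rw [h]
  exact 𝔠.cons.finite_toSet.measurableSet_biInter fun c _ => measurableSet_consSet c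

/-- [folklore] The potential-free factor is measurable. -/
theorem measurable_chi : Measurable 𝔠.chi :=
  measurable_const.indicator 𝔠.measurableSet_chiSet

omit [BorelSpace V] in
/-! ## §3 The history read-out through the table -/

/-- THE HISTORY READ-OUT `h ↦ Σ_{Y∈𝐃} τ(Y)·𝐕″_k(Y, B|_Y; h)` of (2.14) at contour parameter `p` and fluctuation field `v`, as a bounded
linear functional on leaf-06's measurable history space (the `Λ(p, v)` of the shape). [folklore] -/
def readOut (p : PΛ) (v : V) : B13HistM P →L[ℂ] ℂ := ∑ Y ∈ 𝔠.D, 𝔠.τ p Y • VppCLMM P (dom Y) (𝔠.B Y v)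

/-- THE LETTER `N₁ := Σ_{Y∈D} rad Y·level136 (d (dom Y))` (radius times the (1.36)-budget format of the table at `dom Y`). [folklore] -/
def N₁ : ℝ := ∑ Y ∈ 𝔠.D, 𝔠.rad Y * level136 P.consts (C.d (dom Y))

omit [BorelSpace V] in
/-- [folklore] The read-out evaluates to `Σ_{Y∈D} τ p Y·readVpp … y Y v` (leaf-06's read-out of the table `y`). -/
theorem readOut_apply (p : PΛ) (v : V) (y : B13HistM P) :
    𝔠.readOut p v y = ∑ Y ∈ 𝔠.D, 𝔠.τ p Y * readVpp P dom 𝔠.B y Y v := by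
  simp only [readOut, _root_.sum_apply, _root_.smul_apply, smul_eq_mul, readVpp_eq_clm]

omit [BorelSpace V] in
/-- [folklore] **LETTER `N₁`**: `‖readOut p v‖ ≤ N₁`, uniformly in `(p, v)` (weights on the circles, leaf-06's `norm_VppCLMM_le`). -/
theorem norm_readOut_le (p : PΛ) (v : V) : ‖𝔠.readOut p v‖ ≤ 𝔠.N₁ := by
  unfold readOut N₁
  refine (norm_sum_le 𝔠.D fun Y => 𝔠.τ p Y • VppCLMM P (dom Y) (𝔠.B Y v)).trans (Finset.sum_le_sum fun Y _ => ?_)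
  calc ‖𝔠.τ p Y • VppCLMM P (dom Y) (𝔠.B Y v)‖ ≤ ‖𝔠.τ p Y‖ * ‖VppCLMM P (dom Y) (𝔠.B Y v)‖ :=
          ContinuousLinearMap.opNorm_smul_le _ _
    _ ≤ 𝔠.rad Y * level136 P.consts (C.d (dom Y)) :=
        mul_le_mul (𝔠.norm_τ_le p Y) (norm_VppCLMM_le P (dom Y) (𝔠.B Y v)) (norm_nonneg (VppCLMM P (dom Y) (𝔠.B Y v)))
          (𝔠.rad_nonneg Y)

omit [BorelSpace V] in
/-- [folklore] `0 ≤ N₁`. -/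
theorem N₁_nonneg : 0 ≤ 𝔠.N₁ :=
  Finset.sum_nonneg fun Y _ => mul_nonneg (𝔠.rad_nonneg Y) (level136_pos P.pos _).le

omit [BorelSpace V] in
/-- [folklore] For every table `y`, `(p, v) ↦ readOut p v y` is jointly measurable (measurable `τ`, measurable field maps, measurable
tables — leaf-06's `measurable_readVpp`). -/
theorem measurable_readOut_apply (y : B13HistM P) : Measurable fun z : PΛ × V => 𝔠.readOut z.1 z.2 y := by
  have h : (fun z : PΛ × V => 𝔠.readOut z.1 z.2 y) = fun z => ∑ Y ∈ 𝔠.D, 𝔠.τ z.1 Y * readVpp P dom 𝔠.B y Y z.2 :=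
    funext fun z => 𝔠.readOut_apply z.1 z.2 y
  rw [h]
  exact Finset.measurable_sum _ fun Y _ =>
    ((𝔠.measτ Y).comp measurable_fst).mul ((measurable_readVpp P dom 𝔠.B 𝔠.measB y Y).comp measurable_snd)

end BiCore

/-! ## §4 The term of a family of cores and the shape of record -/

section Term

variable {P dom}
variable {Op : Type*} [NormedAddCommGroup Op] [NormedSpace ℂ Op] {ι : Type*}
  {β : ℕ → ι → Type*} [∀ k i, MeasurableSpace (β k i)]
  {α : ℕ → ι → Type*} [∀ k i, NormedAddCommGroup (α k i)] [∀ k i, InnerProductSpace ℝ (α k i)]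
  [∀ k i, FiniteDimensional ℝ (α k i)] [∀ k i, MeasurableSpace (α k i)] [∀ k i, BorelSpace (α k i)]

/-- THE TERM OF A FAMILY OF CORES `𝔊 k i X` (one core per step `k`, term index `i`, localization domain `X`): the ITERATED integral
`∫ w(p)·N(o, p)·(∫ chi(v)·exp(readOut(p, v)·h)·exp(−q(o, p, v)) dvol(v)) dlam(p)` — (2.14) read in the format of record. [folklore] -/
def termBi (𝔊 : ∀ k i, C.Dom → BiCore P dom Op (β k i) (α k i)) : ℕ → ι → Op → B13HistM P → C.Dom → ℂ :=
  fun k i o h X => ∫ p, (𝔊 k i X).w p * (𝔊 k i X).N o p *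
    ∫ v, (𝔊 k i X).chi v * Complex.exp ((𝔊 k i X).readOut p v h) * Complex.exp (-(𝔊 k i X).q o p v) ∂volume ∂(𝔊 k i X).lam

/-- **THE SHAPE OF RECORD FROM THE CORES** (R18 (a) + the structural half of (b)): for any window `W`, class centres `ctr`, history
radius `RHist` and operator radius `R′`, the family's term `termBi 𝔊` satisfies `TermGaussianParamBi` with parameter measures `lam`,
weights `w` (bound `wB`), normalisations `N`, potential-free factor `chi` (bound `F = 1`, §2), read-out `readOut` (bound `N₁`, §3),
exponent `q`, PROVIDED the operator letters hold on the open operator ball of every class centre: `0 < m`; `N(o, ·)` a.e.-strongly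
measurable, `N(·, p)` holomorphic, `‖N‖ ≤ N₀`; `q(o, ·, ·)` jointly a.e.-strongly measurable, `q(·, p, v)` holomorphic, affine margin
`m‖v‖² − b ≤ Re q` (§5 produces the last from base-point data).  The representation clause holds BY CONSTRUCTION. [folklore] -/
theorem termGaussianParamBi_termBi {W : Set (ℕ → ℝ)} {ctr : ℕ → (ℕ → ℝ) → C.BgB → Op × B13HistM P} {RHist R' : ℕ → ℝ}
    (𝔊 : ∀ k i, C.Dom → BiCore P dom Op (β k i) (α k i)) {m b N₀ : ℕ → ι → C.Dom → ℝ}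
    (hm : ∀ k, ∀ g ∈ W, ∀ (U : C.BgB) (X : C.Dom), C.scale X = k → ∀ i, 0 < m k i X)
    (hN : ∀ k, ∀ g ∈ W, ∀ (U : C.BgB) (X : C.Dom), C.scale X = k → ∀ i,
      (∀ o ∈ ball (ctr k g U).1 (R' k), AEStronglyMeasurable ((𝔊 k i X).N o) (𝔊 k i X).lam) ∧
      (∀ p, DifferentiableOn ℂ (fun o => (𝔊 k i X).N o p) (ball (ctr k g U).1 (R' k))) ∧
      (∀ o ∈ ball (ctr k g U).1 (R' k), ∀ p, ‖(𝔊 k i X).N o p‖ ≤ N₀ k i X))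
    (hq : ∀ k, ∀ g ∈ W, ∀ (U : C.BgB) (X : C.Dom), C.scale X = k → ∀ i,
      (∀ o ∈ ball (ctr k g U).1 (R' k),
        AEStronglyMeasurable (Function.uncurry ((𝔊 k i X).q o)) ((𝔊 k i X).lam.prod volume)) ∧
      (∀ p v, DifferentiableOn ℂ (fun o => (𝔊 k i X).q o p v) (ball (ctr k g U).1 (R' k))) ∧
      (∀ o ∈ ball (ctr k g U).1 (R' k), ∀ p v, m k i X * ‖v‖ ^ 2 - b k i X ≤ ((𝔊 k i X).q o p v).re)) :
    TermGaussianParamBi (termBi 𝔊) W ctr RHist R' (fun k i X => (𝔊 k i X).lam) (fun k i X => (𝔊 k i X).w)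
      (fun k i X => (𝔊 k i X).N) (fun k i X _ v => (𝔊 k i X).chi v) (fun k i X => (𝔊 k i X).readOut)
      (fun k i X => (𝔊 k i X).q) m b (fun k i X => (𝔊 k i X).wB) N₀ (fun _ _ _ => 1) fun k i X => (𝔊 k i X).N₁ := by
  intro k g hg U X hX i
  obtain ⟨hNm, hNh, hNb⟩ := hN k g hg U X hX i
  obtain ⟨hqm, hqh, hqre⟩ := hq k g hg U X hX i
  haveI := (𝔊 k i X).finite
  refine ⟨(𝔊 k i X).finite, hm k g hg U X hX i, (𝔊 k i X).measW.aestronglyMeasurable, (𝔊 k i X).norm_w_le, hNm, hNh, hNb,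
    ((𝔊 k i X).measurable_chi.comp measurable_snd).aestronglyMeasurable, fun _ v => (𝔊 k i X).norm_chi_le_one v,
    fun y => ((𝔊 k i X).measurable_readOut_apply y).aestronglyMeasurable, fun p v => (𝔊 k i X).norm_readOut_le p v,
    (𝔊 k i X).N₁_nonneg, hqm, hqh, hqre, fun o _ h _ => rfl⟩

end Term

/-! ## §5 The affine margin from the decoupled base point -/

section Margin

variable {P dom}
variable {Op PΛ V : Type*} [NormedAddCommGroup Op] [MeasurableSpace PΛ] [NormedAddCommGroup V] [InnerProductSpace ℝ V]
  [MeasurableSpace V] (𝔠 : BiCore P dom Op PΛ V)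

/-- **THE MARGIN BINDER OF §4 FROM BASE-POINT DATA** (the owner's `re_ge_shift_of_baseMargin_param_lipschitz` read for a core): if at
the base operator datum `c` the DECOUPLED exponent `q₀` (σ(Z) = 0, [II] (2.15) KIND) has `Re q₀(v) ≥ m₀‖v‖² − b`, the σ-coupling moves
the exponent by at most `m₂‖v‖²` (`‖q(c, p, v) − q₀(v)‖ ≤ m₂‖v‖²`, printed KIND (2.15)–(2.17)∕(2.21)) and the operator dependence is
Lipschitz with slope `m₁‖v‖²`, then on `ball c R′` the core's exponent has the affine margin `(m₀ − m₂ − m₁R′)‖v‖² − b ≤ Re q(o, p, v)` —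
alive iff `m₂ + m₁R′ < m₀` (ARITHMETIC; the three letters are the instancer's). [folklore] -/
theorem margin_of_base {q₀ : V → ℂ} {c : Op} {m₀ m₁ m₂ R' b : ℝ} (hm₁ : 0 ≤ m₁)
    (hbase : ∀ v, m₀ * ‖v‖ ^ 2 - b ≤ (q₀ v).re) (hpar : ∀ p v, ‖𝔠.q c p v - q₀ v‖ ≤ m₂ * ‖v‖ ^ 2)
    (hlip : ∀ o p v, ‖𝔠.q o p v - 𝔠.q c p v‖ ≤ m₁ * ‖o - c‖ * ‖v‖ ^ 2) :
    ∀ o ∈ ball c R', ∀ p v, (m₀ - m₂ - m₁ * R') * ‖v‖ ^ 2 - b ≤ (𝔠.q o p v).re :=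
  fun _ ho p v => re_ge_shift_of_baseMargin_param_lipschitz (N := fun v => ‖v‖ ^ 2) (fun _ => by positivity) hm₁ hbase hpar hlip ho p v

/-- [folklore] …and the margin is POSITIVE exactly in the printed regime `m₂ + m₁R′ < m₀`. -/
theorem margin_pos {m₀ m₁ m₂ R' : ℝ} (h : m₂ + m₁ * R' < m₀) : 0 < m₀ - m₂ - m₁ * R' := by linarith

end Margin

/-! ## §6 Non-vacuity: the displayed operator letters are jointly satisfiable on a core -/

section Witness

variable {P}
variable {Op : Type*} [NormedAddCommGroup Op] [NormedSpace ℂ Op] {ι : Type*}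
  {β : ℕ → ι → Type*} [∀ k i, MeasurableSpace (β k i)]
  {α : ℕ → ι → Type*} [∀ k i, NormedAddCommGroup (α k i)] [∀ k i, InnerProductSpace ℝ (α k i)]
  [∀ k i, FiniteDimensional ℝ (α k i)] [∀ k i, MeasurableSpace (α k i)] [∀ k i, BorelSpace (α k i)]

/-- **NON-VACUITY OF §4's DISPLAYED BINDERS** (a test, not a model of [II]): for ANY family of cores whose operator letters are the
decoupled toy values `N := 1`, `q(o, p, v) := ‖v‖²` (no operator dependence), the binders `hm`∕`hN`∕`hq` of `termGaussianParamBi_termBi`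
hold with `m := 1`, `b := 0`, `N₀ := 1`, so the shape of record is inhabited by `termBi` of such cores — the §4 binders are jointly
satisfiable and the theorem is not vacuous. [folklore] -/
theorem termGaussianParamBi_termBi_toy {W : Set (ℕ → ℝ)} {ctr : ℕ → (ℕ → ℝ) → C.BgB → Op × B13HistM P} {RHist R' : ℕ → ℝ}
    (𝔊 : ∀ k i, C.Dom → BiCore P dom Op (β k i) (α k i)) (hN1 : ∀ k i X o p, (𝔊 k i X).N o p = 1)
    (hq1 : ∀ k i X o p v, (𝔊 k i X).q o p v = ((‖v‖ ^ 2 : ℝ) : ℂ)) :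
    TermGaussianParamBi (termBi 𝔊) W ctr RHist R' (fun k i X => (𝔊 k i X).lam) (fun k i X => (𝔊 k i X).w)
      (fun k i X => (𝔊 k i X).N) (fun k i X _ v => (𝔊 k i X).chi v) (fun k i X => (𝔊 k i X).readOut)
      (fun k i X => (𝔊 k i X).q) (fun _ _ _ => 1) (fun _ _ _ => 0) (fun k i X => (𝔊 k i X).wB) (fun _ _ _ => 1) (fun _ _ _ => 1)
      fun k i X => (𝔊 k i X).N₁ := by
  have hNf : ∀ k i X o, (𝔊 k i X).N o = fun _ => 1 := fun k i X o => funext (hN1 k i X o)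
  have hqf : ∀ k i X o, Function.uncurry ((𝔊 k i X).q o) = fun z => ((‖z.2‖ ^ 2 : ℝ) : ℂ) :=
    fun k i X o => funext fun z => hq1 k i X o z.1 z.2
  refine termGaussianParamBi_termBi 𝔊 (fun _ _ _ _ _ _ _ => one_pos) (fun k _ _ _ X _ i => ⟨?_, ?_, ?_⟩) fun k _ _ _ X _ i => ⟨?_, ?_, ?_⟩
  · intro o _; rw [hNf]; exact aestronglyMeasurable_const
  · intro p
    have : (fun o => (𝔊 k i X).N o p) = fun _ => 1 := funext fun o => hN1 k i X o p
    rw [this]; exact differentiableOn_const 1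
  · intro o _ p; rw [hN1]; simp
  · intro o _; rw [hqf]
    exact (Complex.measurable_ofReal.comp ((measurable_snd.norm).pow_const 2)).aestronglyMeasurable
  · intro p v
    have : (fun o => (𝔊 k i X).q o p v) = fun _ => ((‖v‖ ^ 2 : ℝ) : ℂ) := funext fun o => hq1 k i X o p v
    rw [this]; exact differentiableOn_const _
  · intro o _ p v; rw [hq1, Complex.ofReal_re]; simp

end Witness

end Summit.QuantumFields.BalabanUV.T4Continuum.B13TermParamGaussianBi

end
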